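import Summits.Ventures.CertifiedArithmetic.LowPrec.EnvelopesMixedE3M2

/-!
# Exhaustive envelopes of the mixed pairs with an FP4 operand, into either operand format (RNE)

HONEST FRAMING (venture CertifiedArithmetic / cell `pub-lowprec`): certified error envelopes and
provably optimal rounding/accumulation schemes for low-precision formats under stated cost models;
every table by two implementations; no hardware or vendor claims.

Completes the kernel-checked self-destination tables of the FP6/FP4 operand matrix: the same-format
pairs are `EnvelopesE2M1/E3M2/E2M3`, the mixed FP6 pair `E3M2 ∘ E2M3` (both destinations) is
`EnvelopesMixedE3M2/E2M3`; this file adds the two mixed pairs with an `E2M1` operand, each into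
BOTH operand formats (`64 × 16` ordered pairs per pair; products and sums commute, so the enum
seat's ordered tables `(E2M1, E3M2)` and `(E2M1, E2M3)` — campaign `fp6fp4mixed`, implementation
A = implementation B — are the transposes). Per (pair, destination): absolute envelope by exponent
code of the rounded result (products, sums), the sharp relative constant on the destination's
NORMAL range (the Theorem E5 constant of ENVELOPES.md: `1/9` for `E3M2`, `1/17` resp. `1/21` for
`E2M3`, `1/5` for `E2M1`; below the normal range ties-to-even can flush a nonzero result to `0`, so
no global constant < 1 exists for most of these tables), and exact / overflow counts. All by
`decide +kernel`, reusing `envTestH` / `countPairsH` (no new definitions). Constants proposed by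
implementation A (`HOME/lean/enum/gen_envelopes_mixed_fp4*.py`), which also reproduces the eight
landed constants/counts of `EnvelopesMixedE3M2/E2M3` exactly.
-/

namespace Summit.Ventures.CertifiedArithmetic

open Literature.ComputerArithmetic.FloatingPoint
open Literature.ComputerArithmetic.FloatingPoint.MiniFloat
open Literature.ComputerArithmetic.FloatingPoint.Format

/-- `E3M2 * E2M1 → E3M2` (RNE, saturating), absolute envelope by exponent code of the rounded
result, in-range products (implementation A's per-binade maxima, kernel-confirmed):
`[1/32, 1/32, 1/16, 1/8, 1/4, 1/2, 1, 2]`. -/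
theorem E3M2_E2M1_mul_E3M2_abs_envelope (a : MiniFloat E3M2) (b : MiniFloat E2M1)
    (h : |a.toRat * b.toRat| ≤ E3M2.maxRat) :
    |(roundNE E3M2 (a.toRat * b.toRat)).toRat - (a.toRat * b.toRat)|
      ≤ ([1/32, 1/32, 1/16, 1/8, 1/4, 1/2, 1, 2] : List ℚ).getD
        (roundNE E3M2 (a.toRat * b.toRat)).expCode 0 := by
  have := forall₂_of_all_all
    (P := envTestH E3M2 (· * ·) [1/32, 1/32, 1/16, 1/8, 1/4, 1/2, 1, 2]) (by decide +kernel) a b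
  exact of_decide_eq_true this h

/-- `E3M2 * E2M1 → E3M2`, sharp NORMAL-RANGE relative constant: for exact products `t` with
`1/4 ≤ |t| ≤ maxRat` (the normal range of `E3M2`), `|fl(t) - t| ≤ 1/9 · |t|`
(= u/(1+u) of the destination, attained); maximiser e.g. `a = 3/16`, `b = 3/2`
(the ENVELOPES.md / THEOREMS-R1 Theorem E5 constant of this table). -/
theorem E3M2_E2M1_mul_E3M2_rel_normal (a : MiniFloat E3M2) (b : MiniFloat E2M1)
    (hlo : (1 / 4 : ℚ) ≤ |a.toRat * b.toRat|) (hhi : |a.toRat * b.toRat| ≤ E3M2.maxRat) :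
    |(roundNE E3M2 (a.toRat * b.toRat)).toRat - (a.toRat * b.toRat)|
      ≤ 1 / 9 * |a.toRat * b.toRat| := by
  have := forall₂_of_all_all
    (P := fun (a : MiniFloat E3M2) (b : MiniFloat E2M1) =>
      decide ((1 / 4 : ℚ) ≤ |a.toRat * b.toRat| → |a.toRat * b.toRat| ≤ E3M2.maxRat →
        |(roundNE E3M2 (a.toRat * b.toRat)).toRat - (a.toRat * b.toRat)|
          ≤ 1 / 9 * |a.toRat * b.toRat|))
    (by decide +kernel) a b
  exact of_decide_eq_true this hlo hhi

/-- `E3M2 + E2M1 → E3M2` (RNE, saturating), absolute envelope by exponent code of the rounded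
result, in-range sums (implementation A's per-binade maxima, kernel-confirmed):
`[0, 0, 1/16, 1/8, 1/4, 1/2, 1, 2]`. -/
theorem E3M2_E2M1_add_E3M2_abs_envelope (a : MiniFloat E3M2) (b : MiniFloat E2M1)
    (h : |a.toRat + b.toRat| ≤ E3M2.maxRat) :
    |(roundNE E3M2 (a.toRat + b.toRat)).toRat - (a.toRat + b.toRat)|
      ≤ ([0, 0, 1/16, 1/8, 1/4, 1/2, 1, 2] : List ℚ).getD
        (roundNE E3M2 (a.toRat + b.toRat)).expCode 0 := by
  have := forall₂_of_all_all
    (P := envTestH E3M2 (· + ·) [0, 0, 1/16, 1/8, 1/4, 1/2, 1, 2]) (by decide +kernel) a b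
  exact of_decide_eq_true this h

/-- `E3M2 + E2M1 → E3M2`, sharp NORMAL-RANGE relative constant: for exact sums `t` with
`1/4 ≤ |t| ≤ maxRat` (the normal range of `E3M2`), `|fl(t) - t| ≤ 1/9 · |t|`
(= u/(1+u) of the destination, attained); maximiser e.g. `a = 1/16`, `b = 1/2`
(the ENVELOPES.md / THEOREMS-R1 Theorem E5 constant of this table). -/
theorem E3M2_E2M1_add_E3M2_rel_normal (a : MiniFloat E3M2) (b : MiniFloat E2M1)
    (hlo : (1 / 4 : ℚ) ≤ |a.toRat + b.toRat|) (hhi : |a.toRat + b.toRat| ≤ E3M2.maxRat) :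
    |(roundNE E3M2 (a.toRat + b.toRat)).toRat - (a.toRat + b.toRat)|
      ≤ 1 / 9 * |a.toRat + b.toRat| := by
  have := forall₂_of_all_all
    (P := fun (a : MiniFloat E3M2) (b : MiniFloat E2M1) =>
      decide ((1 / 4 : ℚ) ≤ |a.toRat + b.toRat| → |a.toRat + b.toRat| ≤ E3M2.maxRat →
        |(roundNE E3M2 (a.toRat + b.toRat)).toRat - (a.toRat + b.toRat)|
          ≤ 1 / 9 * |a.toRat + b.toRat|))
    (by decide +kernel) a b
  exact of_decide_eq_true this hlo hhi

/-- `E3M2 ∘ E2M1 → E3M2` COUNTS over the 1024 ordered code pairs: exact products / sums and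
overflowing (`|t| > maxRat E3M2`) products / sums =
(680, 540, 132, 16) (implementation A gives the same numbers; its table
statistics count exactness over the cells with no zero operand). -/
theorem E3M2_E2M1_E3M2_counts :
    countPairsH E3M2 E2M1
        (fun a b => decide ((roundNE E3M2 (a.toRat * b.toRat)).toRat = a.toRat * b.toRat)) = 680 ∧
    countPairsH E3M2 E2M1
        (fun a b => decide ((roundNE E3M2 (a.toRat + b.toRat)).toRat = a.toRat + b.toRat)) = 540 ∧
    countPairsH E3M2 E2M1 (fun a b => decide (E3M2.maxRat < |a.toRat * b.toRat|)) = 132 ∧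
    countPairsH E3M2 E2M1 (fun a b => decide (E3M2.maxRat < |a.toRat + b.toRat|)) = 16 := by
  decide +kernel

/-- `E3M2 * E2M1 → E2M1` (RNE, saturating), absolute envelope by exponent code of the rounded
result, in-range products (implementation A's per-binade maxima, kernel-confirmed):
`[1/4, 1/4, 1/2, 1]`. -/
theorem E3M2_E2M1_mul_E2M1_abs_envelope (a : MiniFloat E3M2) (b : MiniFloat E2M1)
    (h : |a.toRat * b.toRat| ≤ E2M1.maxRat) :
    |(roundNE E2M1 (a.toRat * b.toRat)).toRat - (a.toRat * b.toRat)|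
      ≤ ([1/4, 1/4, 1/2, 1] : List ℚ).getD
        (roundNE E2M1 (a.toRat * b.toRat)).expCode 0 := by
  have := forall₂_of_all_all
    (P := envTestH E2M1 (· * ·) [1/4, 1/4, 1/2, 1]) (by decide +kernel) a b
  exact of_decide_eq_true this h

/-- `E3M2 * E2M1 → E2M1`, sharp NORMAL-RANGE relative constant: for exact products `t` with
`1 ≤ |t| ≤ maxRat` (the normal range of `E2M1`), `|fl(t) - t| ≤ 1/5 · |t|`
(= u/(1+u) of the destination, attained); maximiser e.g. `a = 5/16`, `b = 4`
(the ENVELOPES.md / THEOREMS-R1 Theorem E5 constant of this table). -/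
theorem E3M2_E2M1_mul_E2M1_rel_normal (a : MiniFloat E3M2) (b : MiniFloat E2M1)
    (hlo : (1 : ℚ) ≤ |a.toRat * b.toRat|) (hhi : |a.toRat * b.toRat| ≤ E2M1.maxRat) :
    |(roundNE E2M1 (a.toRat * b.toRat)).toRat - (a.toRat * b.toRat)|
      ≤ 1 / 5 * |a.toRat * b.toRat| := by
  have := forall₂_of_all_all
    (P := fun (a : MiniFloat E3M2) (b : MiniFloat E2M1) =>
      decide ((1 : ℚ) ≤ |a.toRat * b.toRat| → |a.toRat * b.toRat| ≤ E2M1.maxRat →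
        |(roundNE E2M1 (a.toRat * b.toRat)).toRat - (a.toRat * b.toRat)|
          ≤ 1 / 5 * |a.toRat * b.toRat|))
    (by decide +kernel) a b
  exact of_decide_eq_true this hlo hhi

/-- `E3M2 + E2M1 → E2M1` (RNE, saturating), absolute envelope by exponent code of the rounded
result, in-range sums (implementation A's per-binade maxima, kernel-confirmed):
`[1/4, 1/4, 1/2, 1]`. -/
theorem E3M2_E2M1_add_E2M1_abs_envelope (a : MiniFloat E3M2) (b : MiniFloat E2M1)
    (h : |a.toRat + b.toRat| ≤ E2M1.maxRat) :
    |(roundNE E2M1 (a.toRat + b.toRat)).toRat - (a.toRat + b.toRat)|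
      ≤ ([1/4, 1/4, 1/2, 1] : List ℚ).getD
        (roundNE E2M1 (a.toRat + b.toRat)).expCode 0 := by
  have := forall₂_of_all_all
    (P := envTestH E2M1 (· + ·) [1/4, 1/4, 1/2, 1]) (by decide +kernel) a b
  exact of_decide_eq_true this h

/-- `E3M2 + E2M1 → E2M1`, sharp NORMAL-RANGE relative constant: for exact sums `t` with
`1 ≤ |t| ≤ maxRat` (the normal range of `E2M1`), `|fl(t) - t| ≤ 1/5 · |t|`
(= u/(1+u) of the destination, attained); maximiser e.g. `a = 1/4`, `b = 1`
(the ENVELOPES.md / THEOREMS-R1 Theorem E5 constant of this table). -/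
theorem E3M2_E2M1_add_E2M1_rel_normal (a : MiniFloat E3M2) (b : MiniFloat E2M1)
    (hlo : (1 : ℚ) ≤ |a.toRat + b.toRat|) (hhi : |a.toRat + b.toRat| ≤ E2M1.maxRat) :
    |(roundNE E2M1 (a.toRat + b.toRat)).toRat - (a.toRat + b.toRat)|
      ≤ 1 / 5 * |a.toRat + b.toRat| := by
  have := forall₂_of_all_all
    (P := fun (a : MiniFloat E3M2) (b : MiniFloat E2M1) =>
      decide ((1 : ℚ) ≤ |a.toRat + b.toRat| → |a.toRat + b.toRat| ≤ E2M1.maxRat →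
        |(roundNE E2M1 (a.toRat + b.toRat)).toRat - (a.toRat + b.toRat)|
          ≤ 1 / 5 * |a.toRat + b.toRat|))
    (by decide +kernel) a b
  exact of_decide_eq_true this hlo hhi

/-- `E3M2 ∘ E2M1 → E2M1` COUNTS over the 1024 ordered code pairs: exact products / sums and
overflowing (`|t| > maxRat E2M1`) products / sums =
(304, 224, 356, 338) (implementation A gives the same numbers; its table
statistics count exactness over the cells with no zero operand). -/
theorem E3M2_E2M1_E2M1_counts :
    countPairsH E3M2 E2M1
        (fun a b => decide ((roundNE E2M1 (a.toRat * b.toRat)).toRat = a.toRat * b.toRat)) = 304 ∧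
    countPairsH E3M2 E2M1
        (fun a b => decide ((roundNE E2M1 (a.toRat + b.toRat)).toRat = a.toRat + b.toRat)) = 224 ∧
    countPairsH E3M2 E2M1 (fun a b => decide (E2M1.maxRat < |a.toRat * b.toRat|)) = 356 ∧
    countPairsH E3M2 E2M1 (fun a b => decide (E2M1.maxRat < |a.toRat + b.toRat|)) = 338 := by
  decide +kernel

/-- `E2M3 * E2M1 → E2M3` (RNE, saturating), absolute envelope by exponent code of the rounded
result, in-range products (implementation A's per-binade maxima, kernel-confirmed):
`[1/16, 1/16, 1/8, 1/4]`. -/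
theorem E2M3_E2M1_mul_E2M3_abs_envelope (a : MiniFloat E2M3) (b : MiniFloat E2M1)
    (h : |a.toRat * b.toRat| ≤ E2M3.maxRat) :
    |(roundNE E2M3 (a.toRat * b.toRat)).toRat - (a.toRat * b.toRat)|
      ≤ ([1/16, 1/16, 1/8, 1/4] : List ℚ).getD
        (roundNE E2M3 (a.toRat * b.toRat)).expCode 0 := by
  have := forall₂_of_all_all
    (P := envTestH E2M3 (· * ·) [1/16, 1/16, 1/8, 1/4]) (by decide +kernel) a b
  exact of_decide_eq_true this h

/-- `E2M3 * E2M1 → E2M3`, sharp NORMAL-RANGE relative constant: for exact products `t` with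
`1 ≤ |t| ≤ maxRat` (the normal range of `E2M3`), `|fl(t) - t| ≤ 1/21 · |t|`
(< u/(1+u) = 1/17, which is not attained); maximiser e.g. `a = 7/8`, `b = 3/2`
(the ENVELOPES.md / THEOREMS-R1 Theorem E5 constant of this table). -/
theorem E2M3_E2M1_mul_E2M3_rel_normal (a : MiniFloat E2M3) (b : MiniFloat E2M1)
    (hlo : (1 : ℚ) ≤ |a.toRat * b.toRat|) (hhi : |a.toRat * b.toRat| ≤ E2M3.maxRat) :
    |(roundNE E2M3 (a.toRat * b.toRat)).toRat - (a.toRat * b.toRat)|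
      ≤ 1 / 21 * |a.toRat * b.toRat| := by
  have := forall₂_of_all_all
    (P := fun (a : MiniFloat E2M3) (b : MiniFloat E2M1) =>
      decide ((1 : ℚ) ≤ |a.toRat * b.toRat| → |a.toRat * b.toRat| ≤ E2M3.maxRat →
        |(roundNE E2M3 (a.toRat * b.toRat)).toRat - (a.toRat * b.toRat)|
          ≤ 1 / 21 * |a.toRat * b.toRat|))
    (by decide +kernel) a b
  exact of_decide_eq_true this hlo hhi

/-- `E2M3 + E2M1 → E2M3` (RNE, saturating), absolute envelope by exponent code of the rounded
result, in-range sums (implementation A's per-binade maxima, kernel-confirmed):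
`[0, 0, 1/8, 1/4]`. -/
theorem E2M3_E2M1_add_E2M3_abs_envelope (a : MiniFloat E2M3) (b : MiniFloat E2M1)
    (h : |a.toRat + b.toRat| ≤ E2M3.maxRat) :
    |(roundNE E2M3 (a.toRat + b.toRat)).toRat - (a.toRat + b.toRat)|
      ≤ ([0, 0, 1/8, 1/4] : List ℚ).getD
        (roundNE E2M3 (a.toRat + b.toRat)).expCode 0 := by
  have := forall₂_of_all_all
    (P := envTestH E2M3 (· + ·) [0, 0, 1/8, 1/4]) (by decide +kernel) a b
  exact of_decide_eq_true this h

/-- `E2M3 + E2M1 → E2M3`, sharp NORMAL-RANGE relative constant: for exact sums `t` with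
`1 ≤ |t| ≤ maxRat` (the normal range of `E2M3`), `|fl(t) - t| ≤ 1/17 · |t|`
(= u/(1+u) of the destination, attained); maximiser e.g. `a = 1/8`, `b = 2`
(the ENVELOPES.md / THEOREMS-R1 Theorem E5 constant of this table). -/
theorem E2M3_E2M1_add_E2M3_rel_normal (a : MiniFloat E2M3) (b : MiniFloat E2M1)
    (hlo : (1 : ℚ) ≤ |a.toRat + b.toRat|) (hhi : |a.toRat + b.toRat| ≤ E2M3.maxRat) :
    |(roundNE E2M3 (a.toRat + b.toRat)).toRat - (a.toRat + b.toRat)|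
      ≤ 1 / 17 * |a.toRat + b.toRat| := by
  have := forall₂_of_all_all
    (P := fun (a : MiniFloat E2M3) (b : MiniFloat E2M1) =>
      decide ((1 : ℚ) ≤ |a.toRat + b.toRat| → |a.toRat + b.toRat| ≤ E2M3.maxRat →
        |(roundNE E2M3 (a.toRat + b.toRat)).toRat - (a.toRat + b.toRat)|
          ≤ 1 / 17 * |a.toRat + b.toRat|))
    (by decide +kernel) a b
  exact of_decide_eq_true this hlo hhi

/-- `E2M3 ∘ E2M1 → E2M3` COUNTS over the 1024 ordered code pairs: exact products / sums and
overflowing (`|t| > maxRat E2M3`) products / sums =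
(644, 752, 252, 88) (implementation A gives the same numbers; its table
statistics count exactness over the cells with no zero operand). -/
theorem E2M3_E2M1_E2M3_counts :
    countPairsH E2M3 E2M1
        (fun a b => decide ((roundNE E2M3 (a.toRat * b.toRat)).toRat = a.toRat * b.toRat)) = 644 ∧
    countPairsH E2M3 E2M1
        (fun a b => decide ((roundNE E2M3 (a.toRat + b.toRat)).toRat = a.toRat + b.toRat)) = 752 ∧
    countPairsH E2M3 E2M1 (fun a b => decide (E2M3.maxRat < |a.toRat * b.toRat|)) = 252 ∧
    countPairsH E2M3 E2M1 (fun a b => decide (E2M3.maxRat < |a.toRat + b.toRat|)) = 88 := by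
  decide +kernel

/-- `E2M3 * E2M1 → E2M1` (RNE, saturating), absolute envelope by exponent code of the rounded
result, in-range products (implementation A's per-binade maxima, kernel-confirmed):
`[1/4, 1/4, 1/2, 1]`. -/
theorem E2M3_E2M1_mul_E2M1_abs_envelope (a : MiniFloat E2M3) (b : MiniFloat E2M1)
    (h : |a.toRat * b.toRat| ≤ E2M1.maxRat) :
    |(roundNE E2M1 (a.toRat * b.toRat)).toRat - (a.toRat * b.toRat)|
      ≤ ([1/4, 1/4, 1/2, 1] : List ℚ).getD
        (roundNE E2M1 (a.toRat * b.toRat)).expCode 0 := by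
  have := forall₂_of_all_all
    (P := envTestH E2M1 (· * ·) [1/4, 1/4, 1/2, 1]) (by decide +kernel) a b
  exact of_decide_eq_true this h

/-- `E2M3 * E2M1 → E2M1`, sharp NORMAL-RANGE relative constant: for exact products `t` with
`1 ≤ |t| ≤ maxRat` (the normal range of `E2M1`), `|fl(t) - t| ≤ 1/5 · |t|`
(= u/(1+u) of the destination, attained); maximiser e.g. `a = 5/8`, `b = 2`
(the ENVELOPES.md / THEOREMS-R1 Theorem E5 constant of this table). -/
theorem E2M3_E2M1_mul_E2M1_rel_normal (a : MiniFloat E2M3) (b : MiniFloat E2M1)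
    (hlo : (1 : ℚ) ≤ |a.toRat * b.toRat|) (hhi : |a.toRat * b.toRat| ≤ E2M1.maxRat) :
    |(roundNE E2M1 (a.toRat * b.toRat)).toRat - (a.toRat * b.toRat)|
      ≤ 1 / 5 * |a.toRat * b.toRat| := by
  have := forall₂_of_all_all
    (P := fun (a : MiniFloat E2M3) (b : MiniFloat E2M1) =>
      decide ((1 : ℚ) ≤ |a.toRat * b.toRat| → |a.toRat * b.toRat| ≤ E2M1.maxRat →
        |(roundNE E2M1 (a.toRat * b.toRat)).toRat - (a.toRat * b.toRat)|
          ≤ 1 / 5 * |a.toRat * b.toRat|))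
    (by decide +kernel) a b
  exact of_decide_eq_true this hlo hhi

/-- `E2M3 + E2M1 → E2M1` (RNE, saturating), absolute envelope by exponent code of the rounded
result, in-range sums (implementation A's per-binade maxima, kernel-confirmed):
`[1/4, 1/4, 1/2, 1]`. -/
theorem E2M3_E2M1_add_E2M1_abs_envelope (a : MiniFloat E2M3) (b : MiniFloat E2M1)
    (h : |a.toRat + b.toRat| ≤ E2M1.maxRat) :
    |(roundNE E2M1 (a.toRat + b.toRat)).toRat - (a.toRat + b.toRat)|
      ≤ ([1/4, 1/4, 1/2, 1] : List ℚ).getD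
        (roundNE E2M1 (a.toRat + b.toRat)).expCode 0 := by
  have := forall₂_of_all_all
    (P := envTestH E2M1 (· + ·) [1/4, 1/4, 1/2, 1]) (by decide +kernel) a b
  exact of_decide_eq_true this h

/-- `E2M3 + E2M1 → E2M1`, sharp NORMAL-RANGE relative constant: for exact sums `t` with
`1 ≤ |t| ≤ maxRat` (the normal range of `E2M1`), `|fl(t) - t| ≤ 1/5 · |t|`
(= u/(1+u) of the destination, attained); maximiser e.g. `a = 1/4`, `b = 1`
(the ENVELOPES.md / THEOREMS-R1 Theorem E5 constant of this table). -/
theorem E2M3_E2M1_add_E2M1_rel_normal (a : MiniFloat E2M3) (b : MiniFloat E2M1)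
    (hlo : (1 : ℚ) ≤ |a.toRat + b.toRat|) (hhi : |a.toRat + b.toRat| ≤ E2M1.maxRat) :
    |(roundNE E2M1 (a.toRat + b.toRat)).toRat - (a.toRat + b.toRat)|
      ≤ 1 / 5 * |a.toRat + b.toRat| := by
  have := forall₂_of_all_all
    (P := fun (a : MiniFloat E2M3) (b : MiniFloat E2M1) =>
      decide ((1 : ℚ) ≤ |a.toRat + b.toRat| → |a.toRat + b.toRat| ≤ E2M1.maxRat →
        |(roundNE E2M1 (a.toRat + b.toRat)).toRat - (a.toRat + b.toRat)|
          ≤ 1 / 5 * |a.toRat + b.toRat|))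
    (by decide +kernel) a b
  exact of_decide_eq_true this hlo hhi

/-- `E2M3 ∘ E2M1 → E2M1` COUNTS over the 1024 ordered code pairs: exact products / sums and
overflowing (`|t| > maxRat E2M1`) products / sums =
(296, 240, 312, 176) (implementation A gives the same numbers; its table
statistics count exactness over the cells with no zero operand). -/
theorem E2M3_E2M1_E2M1_counts :
    countPairsH E2M3 E2M1
        (fun a b => decide ((roundNE E2M1 (a.toRat * b.toRat)).toRat = a.toRat * b.toRat)) = 296 ∧
    countPairsH E2M3 E2M1
        (fun a b => decide ((roundNE E2M1 (a.toRat + b.toRat)).toRat = a.toRat + b.toRat)) = 240 ∧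
    countPairsH E2M3 E2M1 (fun a b => decide (E2M1.maxRat < |a.toRat * b.toRat|)) = 312 ∧
    countPairsH E2M3 E2M1 (fun a b => decide (E2M1.maxRat < |a.toRat + b.toRat|)) = 176 := by
  decide +kernel

end Summit.Ventures.CertifiedArithmetic
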